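import Mathlib
import Literature.AlgebraicGeometry.ShimuraVarieties.UnitaryBallLocalBiholomorphy
import Literature.AlgebraicGeometry.ShimuraVarieties.UnitaryBallUnfolding
import Literature.NumberTheory.Transcendental.FormIntegrationCharts
import HarnessLib

/-!
# The chart density of a top form along the ball uniformization

For a unitary ball-quotient datum `D : UnitaryBallUniformisationDatum 2 X₂`, a Hodge model `A` of `X₂`
(real model space `A.model` of dimension `4`) and a Sylvester frame `𝔣`, let
`ψ = D.modelUnif A 𝔣 : ℂ² → X^an` be the uniformization (a `Γ`-invariant local biholomorphism of
the ball onto `X^an`). For a top-degree form `β` on `X^an` we define its **density on the ball**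
`topDensity β z = β_{ψ z}(dψ_z b₁, …, dψ_z b₄)` with respect to the standard real basis
`b = (e₀, i e₀, e₁, i e₁)` of `ℂ²` (`ballBasis`), and PROVE:

* `altTop_apply_equiv_comp` — linear algebra: for a top-degree alternating form `ω` on `E`, a
  linear isomorphism `L : V ≃ E`, an endomorphism `T` of `V` and a basis `b` of `V`,
  `ω (L ∘ T ∘ b) = det T · ω (L ∘ b)`;
* `topDensity_eq_det_mul` — the **transformation rule** `topDensity β z = det_ℝ J(γ, z) ·
  topDensity β (γ z)` for `γ ∈ Γ` (chain rule `dψ_z = dψ_{γ z} ∘ J(γ, z)`), and the same for the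
  orientation values `orientVal`, whence the `Γ`-invariance of the orientation sign `orientSign`;
* `ChartInverseAt x₀ z` / `nonempty_chartInverseAt` — a holomorphic local inverse `g` of `ψ` read in
  the chart of `X^an` centred at an ARBITRARY point `x₀` whose chart domain contains `ψ z`
  (generalising `UnitaryBallUniformisationDatum.ChartInverse`, the case `x₀ = ψ z`), with the chain rule
  `d(c⁻¹)_y = dψ_{g y} ∘ dg_y`;
* `inChart_apply_modelBasis_eq`, `chartSign_eq` — in such a chart, the chart representative of `β`
  and the orientation sign are `det T_y · topDensity β (g y)` and `sign (det T_y) · orientSign (g y)`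
  with `T_y = dg_y ∘ Θ` (`Θ : ℂ² ≃ A.model` the fixed identification sending `b` to the reference
  basis `modelBasis A.model 4`), so that the integrand of `∫_X β` in the chart is
  `|det T_y| · (orientSign · topDensity β) (g y)` (`chartIntegrand_eq`).

These are the pointwise identities behind the computation of `∫_{X^an} β` as an integral over a
fundamental domain of `Γ` in the ball (file `UnitaryBallChartFormula`).

References: [Warner1983, §4.8] (integration of top forms via charts and partitions of unity),
[Lee2013, Ch. 16, Prop. 16.6] (change of variables / diffeomorphism invariance),
[VoisinHodgeI2002, §2.2.1] (holomorphic maps have `ℂ`-linear differentials).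

## Provenance

Written under the LEAN-IN-TREE rule for the pub-hodgecm formalisation cell (model-construction
sub-cell, seat mc-unitary-3 gen 2, node D2-chart). Everything here is kernel-checked; nothing is a
claim of the manuscripts adjudicated by that cell.
-/

set_option autoImplicit false

noncomputable section

open Matrix MulAction Function Set Filter Complex Module
open scoped Manifold Topology
open Literature.Geometry.ComplexHyperbolic
open Literature.Geometry.ComplexHyperbolic.BallModel (U21 Ball Jac nsq actVec)
open Literature.NumberTheory.Transcendental
open Literature.AlgebraicGeometry.HodgeTheory (HodgeModel)
open Literature.Geometry.Kaehler (MForm)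
open Literature.Analysis.Complex

namespace Literature.AlgebraicGeometry.ShimuraVarieties

/-! ### Linear algebra: top forms under `L ∘ T` -/

/-- **Top-degree alternating forms transform by the determinant**: for `ω` a top form on `E`,
`L : V ≃ E` linear, `T` an endomorphism of `V` and `b` a basis of `V` (indexed by `Fin n`),
`ω (k ↦ L (T (b k))) = det T · ω (k ↦ L (b k))`. [folklore] -/
theorem altTop_apply_equiv_comp {V E : Type*} [AddCommGroup V] [Module ℝ V] [AddCommGroup E]
    [Module ℝ E] {n : ℕ} (ω : E [⋀^Fin n]→ₗ[ℝ] ℝ) (L : V ≃ₗ[ℝ] E) (T : V →ₗ[ℝ] V)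
    (b : Basis (Fin n) ℝ V) :
    ω (fun k ↦ L (T (b k))) = LinearMap.det T * ω (fun k ↦ L (b k)) := by
  set B : Basis (Fin n) ℝ E := b.map L with hB
  have hBk : ∀ k, B k = L (b k) := fun k ↦ by rw [hB, Basis.map_apply]
  set f : E →ₗ[ℝ] E := (L : V →ₗ[ℝ] E) ∘ₗ T ∘ₗ (L.symm : E →ₗ[ℝ] V) with hf
  have hv : (fun k ↦ L (T (b k))) = f ∘ B := by
    funext k
    simp only [Function.comp_apply, hBk, hf, LinearMap.coe_comp, LinearEquiv.coe_coe,
      LinearEquiv.symm_apply_apply]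
  have hw : (fun k ↦ L (b k)) = (B : Fin n → E) := by
    funext k; exact (hBk k).symm
  rw [hv, hw]
  have h1 : ω (f ∘ B) = ω B * B.det (f ∘ B) := by
    conv_lhs => rw [ω.eq_smul_basis_det B]
    rfl
  rw [h1, Basis.det_comp, Basis.det_self, mul_one, hf, LinearMap.det_conj, mul_comm]

namespace UnitaryBallUniformisationDatum

variable {X₂ : Motives.SchemeOver ℂ} (D : UnitaryBallUniformisationDatum 2 X₂) (A : HodgeModel 2 X₂)
  (𝔣 : D.SylvesterFrame)

/-! ### Holomorphic local inverses of `ψ` in an arbitrary chart -/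

/-- **A holomorphic local inverse of the uniformization read in the chart `c` of `X^an` centred at
`x₀`**, at a ball point `z` with `ψ z` in the chart domain: an open set `W ∋ c (ψ z)` and
`g : A.model → ℂ²`, complex-differentiable on `W`, with `g (c (ψ z)) = z`, `g(W) ⊆ 𝔹²`,
`W ⊆ c.target` and `c⁻¹ = ψ ∘ g` on `W`. [cite: FritzscheGrauert2002, Ch. I §8 Cor. 8.6] -/
structure ChartInverseAt (x₀ : A.carrier) (z : Ball) where
  /-- the open set of the chart target on which the inverse is defined -/
  W : Set A.model
  /-- the local inverse (total function, meaningful on `W`) -/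
  g : A.model → (Fin 2 → ℂ)
  isOpen : IsOpen W
  center_mem : extChartAt 𝓘(ℝ, A.model) x₀ (D.modelUnif A 𝔣 z.1) ∈ W
  g_center : g (extChartAt 𝓘(ℝ, A.model) x₀ (D.modelUnif A 𝔣 z.1)) = z.1
  differentiableOn : DifferentiableOn ℂ g W
  mapsTo : MapsTo g W BallForms.ballSet
  subset_target : W ⊆ (extChartAt 𝓘(ℝ, A.model) x₀).target
  symm_eq : ∀ y ∈ W, (extChartAt 𝓘(ℝ, A.model) x₀).symm y = D.modelUnif A 𝔣 (g y)

/-- **Existence of holomorphic local inverses in any chart** whose domain contains `ψ z`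
(Clements–Osgood applied to `c ∘ ψ`, injective and holomorphic near `z`).
[cite: FritzscheGrauert2002, Ch. I §8 Cor. 8.6] -/
theorem nonempty_chartInverseAt (x₀ : A.carrier) (z : Ball)
    (hz : D.modelUnif A 𝔣 z.1 ∈ (chartAt A.model x₀).source) :
    Nonempty (D.ChartInverseAt A 𝔣 x₀ z) := by
  set ψ := D.modelUnif A 𝔣 with hψ
  set φ := extChartAt 𝓘(ℝ, A.model) x₀ with hφ
  obtain ⟨U, hUo, hzU, hUB, hinjU⟩ := D.exists_isOpen_injOn_modelUnif A 𝔣 z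
  set O : Set (Fin 2 → ℂ) := U ∩ ψ ⁻¹' (chartAt A.model x₀).source with hO
  have hOo : IsOpen O :=
    ((D.continuousOn_modelUnif A 𝔣).mono hUB).isOpen_inter_preimage hUo
      (chartAt A.model x₀).open_source
  have hzO : z.1 ∈ O := ⟨hzU, hz⟩
  have hOB : O ⊆ BallForms.ballSet := fun w hw ↦ hUB hw.1
  have hsrc : ∀ w ∈ O, ψ w ∈ φ.source := fun w hw ↦ by
    rw [hφ, extChartAt_source]; exact hw.2
  set Y : (Fin 2 → ℂ) → A.model := fun w ↦ φ (ψ w) with hY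
  have hYd : DifferentiableOn ℂ Y O := fun w hw ↦ by
    have h1 : MDifferentiableAt 𝓘(ℂ, Fin 2 → ℂ) 𝓘(ℂ, A.model) ψ w :=
      (D.unifHolomorphic A 𝔣).mdifferentiableAt (BallForms.isOpen_ballSet.mem_nhds (hOB hw))
    have h2 : MDifferentiableAt 𝓘(ℂ, A.model) 𝓘(ℂ, A.model)
        (extChartAt 𝓘(ℂ, A.model) x₀) (ψ w) :=
      mdifferentiableAt_extChartAt hw.2
    exact (mdifferentiableAt_iff_differentiableAt.1 (h2.comp w h1)).differentiableWithinAt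
  have hYinj : InjOn Y O := by
    intro w hw w' hw' h
    exact hinjU hw.1 hw'.1 (φ.injOn (hsrc w hw) (hsrc w' hw') h)
  have hdim := finrank_fin_two_eq_finrank_model A
  haveI : Nonempty (Fin 2 → ℂ) := ⟨0⟩
  set e : PartialEquiv (Fin 2 → ℂ) A.model := hYinj.toPartialEquiv Y O with he
  have hopen : IsOpenMap (O.restrict Y) := by
    intro s hs
    obtain ⟨V, hV, rfl⟩ := isOpen_induced_iff.1 hs
    have himg : O.restrict Y '' (Subtype.val ⁻¹' V) = Y '' (O ∩ V) := by
      ext y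
      constructor
      · rintro ⟨⟨w, hwO⟩, hwV, rfl⟩
        exact ⟨w, ⟨hwO, hwV⟩, rfl⟩
      · rintro ⟨w, ⟨hwO, hwV⟩, rfl⟩
        exact ⟨⟨w, hwO⟩, hwV, rfl⟩
    rw [himg]
    exact SCV.isOpen_image_of_injOn hdim (hYd.mono inter_subset_left) (hOo.inter hV)
      (hYinj.mono inter_subset_left)
  set T : OpenPartialHomeomorph (Fin 2 → ℂ) A.model :=
    OpenPartialHomeomorph.ofContinuousOpenRestrict e hYd.continuousOn hopen hOo with hT
  have hTd : DifferentiableOn ℂ T T.source := hYd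
  have hgd : DifferentiableOn ℂ T.symm (Y '' O) :=
    SCV.differentiableOn_symm_of_differentiableOn hdim T hTd
  refine ⟨{ W := Y '' O
            g := T.symm
            isOpen := SCV.isOpen_image_of_injOn hdim hYd hOo hYinj
            center_mem := ⟨z.1, hzO, rfl⟩
            g_center := T.left_inv hzO
            differentiableOn := hgd
            mapsTo := fun y hy ↦ hOB (T.map_target hy)
            subset_target := ?_
            symm_eq := ?_ }⟩
  · rintro _ ⟨w, hw, rfl⟩
    exact φ.map_source (hsrc w hw)
  · intro y hy
    have hgy : T.symm y ∈ O := T.map_target hy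
    have hright : Y (T.symm y) = y := T.right_inv hy
    calc φ.symm y = φ.symm (Y (T.symm y)) := by rw [hright]
      _ = ψ (T.symm y) := φ.left_inv (hsrc _ hgy)

namespace ChartInverseAt

variable {D A 𝔣} {x₀ : A.carrier} {z : Ball} (c : D.ChartInverseAt A 𝔣 x₀ z)

/-- Points of `W` lie in the chart target. [folklore] -/
theorem mem_target {y : A.model} (hy : y ∈ c.W) : y ∈ (extChartAt 𝓘(ℝ, A.model) x₀).target :=
  c.subset_target hy

/-- The ball point `g y`. [folklore] -/
def gBall {y : A.model} (hy : y ∈ c.W) : Ball :=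
  ⟨c.g y, c.mapsTo hy⟩

/-- `g` is injective on `W` (`c⁻¹ = ψ ∘ g` and `c⁻¹` is injective on the target). [folklore] -/
theorem injOn_g : InjOn c.g c.W := by
  intro y hy y' hy' h
  have h1 : (extChartAt 𝓘(ℝ, A.model) x₀).symm y = (extChartAt 𝓘(ℝ, A.model) x₀).symm y' := by
    rw [c.symm_eq y hy, c.symm_eq y' hy', h]
  exact (extChartAt 𝓘(ℝ, A.model) x₀).symm.injOn (c.mem_target hy) (c.mem_target hy') h1

/-- **Chain rule for `c⁻¹ = ψ ∘ g`**: `d(c⁻¹)_y = dψ_{g y} ∘ dg_y` on `W`.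
[cite: VoisinHodgeI2002, §2.2.1] -/
theorem mfderivWithin_symm_eq {y : A.model} (hy : y ∈ c.W) :
    mfderivWithin 𝓘(ℝ, A.model) 𝓘(ℝ, A.model) (extChartAt 𝓘(ℝ, A.model) x₀).symm
        (range 𝓘(ℝ, A.model)) y =
      (D.unifDeriv A 𝔣 (c.g y)).comp (fderiv ℝ c.g y) := by
  set ψ := D.modelUnif A 𝔣 with hψ
  set φ := extChartAt 𝓘(ℝ, A.model) x₀ with hφ
  have h1 : HasMFDerivAt 𝓘(ℝ, A.model) 𝓘(ℝ, Fin 2 → ℂ) c.g y (fderiv ℝ c.g y) :=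
    hasMFDerivAt_iff_hasFDerivAt.2 ((c.differentiableOn.differentiableAt (c.isOpen.mem_nhds hy)).restrictScalars ℝ).hasFDerivAt
  have h2 : HasMFDerivAt 𝓘(ℝ, Fin 2 → ℂ) 𝓘(ℝ, A.model) ψ (c.g y) (D.unifDeriv A 𝔣 (c.g y)) :=
    (D.mdifferentiableAt_modelUnif A 𝔣 (c.gBall hy)).real_of_complex.hasMFDerivAt
  have h3 : HasMFDerivAt 𝓘(ℝ, A.model) 𝓘(ℝ, A.model) φ.symm y
      (mfderivWithin 𝓘(ℝ, A.model) 𝓘(ℝ, A.model) φ.symm (range 𝓘(ℝ, A.model)) y) :=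
    (mdifferentiableWithinAt_extChartAt_symm (c.mem_target hy)).hasMFDerivWithinAt.hasMFDerivAt
      (by rw [ModelWithCorners.Boundaryless.range_eq_univ]; exact univ_mem)
  have hev : φ.symm =ᶠ[𝓝 y] ψ ∘ c.g := by
    filter_upwards [c.isOpen.mem_nhds hy] with y' hy'
    exact c.symm_eq y' hy'
  rw [← h3.mfderiv]
  exact ((h2.comp y h1).congr_of_eventuallyEq hev).mfderiv

end ChartInverseAt

/-! ### The standard real basis of `ℂ²` and the identification `Θ : ℂ² ≃ A.model` -/

/-- Real coordinates on `ℂ²`: `z ↦ (Re z₀, Im z₀, Re z₁, Im z₁)`. [folklore] -/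
def _root_.Literature.AlgebraicGeometry.ShimuraVarieties.realCoordEquiv :
    (Fin 2 → ℂ) ≃ₗ[ℝ] (Fin 4 → ℝ) where
  toFun z := ![(z 0).re, (z 0).im, (z 1).re, (z 1).im]
  invFun x := ![⟨x 0, x 1⟩, ⟨x 2, x 3⟩]
  map_add' z w := by
    funext k; fin_cases k <;> simp
  map_smul' c z := by
    funext k; fin_cases k <;> simp
  left_inv z := by
    funext i; fin_cases i <;> rfl
  right_inv x := by
    funext k; fin_cases k <;> rfl

/-- **The standard real basis `(e₀, i e₀, e₁, i e₁)` of `ℂ²`.** [folklore] -/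
def _root_.Literature.AlgebraicGeometry.ShimuraVarieties.ballBasis : Basis (Fin 4) ℝ (Fin 2 → ℂ) :=
  Basis.ofEquivFun realCoordEquiv

/-- `ballBasis 0 = e₀`. [folklore] -/
@[simp] theorem _root_.Literature.AlgebraicGeometry.ShimuraVarieties.ballBasis_zero :
    ballBasis 0 = Pi.single 0 1 := by
  rw [ballBasis, Basis.coe_ofEquivFun]
  funext i; fin_cases i <;> simp [realCoordEquiv] <;> rfl

/-- `ballBasis 1 = i e₀`. [folklore] -/
@[simp] theorem _root_.Literature.AlgebraicGeometry.ShimuraVarieties.ballBasis_one :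
    ballBasis 1 = Pi.single 0 Complex.I := by
  rw [ballBasis, Basis.coe_ofEquivFun]
  funext i; fin_cases i <;> simp [realCoordEquiv] <;> rfl

/-- `ballBasis 2 = e₁`. [folklore] -/
@[simp] theorem _root_.Literature.AlgebraicGeometry.ShimuraVarieties.ballBasis_two :
    ballBasis 2 = Pi.single 1 1 := by
  rw [ballBasis, Basis.coe_ofEquivFun]
  funext i; fin_cases i <;> simp [realCoordEquiv] <;> rfl

/-- `ballBasis 3 = i e₁`. [folklore] -/
@[simp] theorem _root_.Literature.AlgebraicGeometry.ShimuraVarieties.ballBasis_three :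
    ballBasis 3 = Pi.single 1 Complex.I := by
  rw [ballBasis, Basis.coe_ofEquivFun]
  funext i; fin_cases i <;> simp [realCoordEquiv] <;> rfl

/-! ### The density of a top form on the ball and the orientation values -/

/-- **The density of a top form along the uniformization**:
`topDensity β z = β_{ψ z}(dψ_z b₁, …, dψ_z b₄)`. [cite: Warner1983, §4.8] -/
def topDensity (β : MForm 𝓘(ℝ, A.model) A.carrier ℝ 4) (z : Ball) : ℝ :=
  β (D.modelUnif A 𝔣 z.1) fun k ↦ D.unifDeriv A 𝔣 z.1 (ballBasis k)

/-- The value of a representative of the orientation `o (ψ z)` on the frame `dψ_z b`.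
[cite: Lee2013, Ch. 15] -/
def orientVal (o : (x : A.carrier) → Orientation ℝ (TangentSpace 𝓘(ℝ, A.model) x) (Fin 4))
    (z : Ball) : ℝ :=
  (o (D.modelUnif A 𝔣 z.1)).someVector fun k ↦ D.unifDeriv A 𝔣 z.1 (ballBasis k)

/-- **The orientation sign on the ball**: `sign (orientVal o z) ∈ {-1, 0, 1}`.
[cite: Lee2013, Ch. 15] -/
def orientSign (o : (x : A.carrier) → Orientation ℝ (TangentSpace 𝓘(ℝ, A.model) x) (Fin 4))
    (z : Ball) : ℝ :=
  Real.sign (D.orientVal A 𝔣 o z)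

/-- Evaluating a form at equal points on the same vectors gives equal values (the tangent spaces
are all the model space). [folklore] -/
theorem mform_apply_congr_point {k : ℕ} (β : MForm 𝓘(ℝ, A.model) A.carrier ℝ k)
    {p q : A.carrier} (h : p = q) (u : Fin k → A.model) : β p u = β q u := by
  subst h; rfl

/-- The same for orientation representatives. [folklore] -/
theorem someVector_apply_congr_point
    (o : (x : A.carrier) → Orientation ℝ (TangentSpace 𝓘(ℝ, A.model) x) (Fin 4))
    {p q : A.carrier} (h : p = q) (u : Fin 4 → A.model) :
    (o p).someVector u = (o q).someVector u := by
  subst h; rfl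

/-- **Transformation rule** `topDensity β z = det_ℝ J(γ, z) · topDensity β (γ z)` (chain rule
`dψ_z = dψ_{γ z} ∘ J(γ,z)` and `ψ (γ z) = ψ z`). [cite: VoisinHodgeI2002, §2.2.1] -/
theorem topDensity_eq_det_mul (β : MForm 𝓘(ℝ, A.model) A.carrier ℝ 4) (γ : D.Γ) (z : Ball) :
    D.topDensity A 𝔣 β z =
      (jacCLM (D.ballRep 𝔣 γ) z).det * D.topDensity A 𝔣 β (D.ballRep 𝔣 γ • z) := by
  unfold topDensity
  rw [mform_apply_congr_point A β (D.modelUnif_smul A 𝔣 γ z).symm, D.unifDeriv_eq_comp A 𝔣 γ z]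
  have h := altTop_apply_equiv_comp ((β (D.modelUnif A 𝔣 (D.ballRep 𝔣 γ • z).1)).toAlternatingMap)
    (D.unifDerivEquiv A 𝔣 (D.ballRep 𝔣 γ • z)).toLinearEquiv
    ((jacCLM (D.ballRep 𝔣 γ) z : (Fin 2 → ℂ) →L[ℝ] (Fin 2 → ℂ)) : (Fin 2 → ℂ) →ₗ[ℝ] (Fin 2 → ℂ))
    ballBasis
  simp only [ContinuousAlternatingMap.coe_toAlternatingMap, ContinuousLinearMap.coe_coe] at h
  exact h

/-- Transformation rule for the orientation values:
`orientVal o z = det_ℝ J(γ, z) · orientVal o (γ z)`. [cite: Lee2013, Ch. 15] -/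
theorem orientVal_eq_det_mul
    (o : (x : A.carrier) → Orientation ℝ (TangentSpace 𝓘(ℝ, A.model) x) (Fin 4)) (γ : D.Γ) (z : Ball) :
    D.orientVal A 𝔣 o z =
      (jacCLM (D.ballRep 𝔣 γ) z).det * D.orientVal A 𝔣 o (D.ballRep 𝔣 γ • z) := by
  unfold orientVal
  rw [someVector_apply_congr_point A o (D.modelUnif_smul A 𝔣 γ z).symm, D.unifDeriv_eq_comp A 𝔣 γ z]
  have h := altTop_apply_equiv_comp ((o (D.modelUnif A 𝔣 (D.ballRep 𝔣 γ • z).1)).someVector)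
    (D.unifDerivEquiv A 𝔣 (D.ballRep 𝔣 γ • z)).toLinearEquiv
    ((jacCLM (D.ballRep 𝔣 γ) z : (Fin 2 → ℂ) →L[ℝ] (Fin 2 → ℂ)) : (Fin 2 → ℂ) →ₗ[ℝ] (Fin 2 → ℂ))
    ballBasis
  simp only [ContinuousLinearMap.coe_coe] at h
  exact h

/-- **The orientation sign is `Γ`-invariant**: `orientSign o (γ z) = orientSign o z`.
[cite: Lee2013, Ch. 15] -/
theorem orientSign_smul
    (o : (x : A.carrier) → Orientation ℝ (TangentSpace 𝓘(ℝ, A.model) x) (Fin 4)) (γ : D.Γ) (z : Ball) :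
    D.orientSign A 𝔣 o (D.ballRep 𝔣 γ • z) = D.orientSign A 𝔣 o z := by
  unfold orientSign
  rw [D.orientVal_eq_det_mul A 𝔣 o γ z, real_sign_mul, Real.sign_of_pos (det_jacCLM_pos _ z),
    one_mul]

/-! ### The identification `Θ` and the chart Jacobian factor -/

variable [Fact (finrank ℝ A.model = 4)]

/-- **The identification `Θ : ℂ² ≃L[ℝ] A.model` matching the standard real basis of `ℂ²`
with the reference basis `modelBasis A.model 4`** used in the definition of `∫_X`. [folklore] -/
def modelIso : (Fin 2 → ℂ) ≃L[ℝ] A.model :=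
  (ballBasis.equiv (modelBasis A.model 4) (Equiv.refl (Fin 4))).toContinuousLinearEquiv

/-- `Θ (ballBasis k) = e k`. [folklore] -/
@[simp] theorem modelIso_ballBasis (k : Fin 4) : modelIso A (ballBasis k) = modelBasis A.model 4 k := by
  change (ballBasis.equiv (modelBasis A.model 4) (Equiv.refl (Fin 4))) (ballBasis k) = _
  rw [Basis.equiv_apply]
  rfl
namespace ChartInverseAt

variable {D A 𝔣} {x₀ : A.carrier} {z : Ball} (c : D.ChartInverseAt A 𝔣 x₀ z)

/-- The endomorphism `T_y = dg_y ∘ Θ` of `ℂ²` whose determinant is the chart Jacobian factor.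
[folklore] -/
def T (y : A.model) : (Fin 2 → ℂ) →L[ℝ] (Fin 2 → ℂ) :=
  (fderiv ℝ c.g y).comp (modelIso A : (Fin 2 → ℂ) →L[ℝ] A.model)

/-- `T_y (b k) = dg_y (e k)`. [folklore] -/
theorem T_ballBasis (y : A.model) (k : Fin 4) :
    c.T y (ballBasis k) = fderiv ℝ c.g y (modelBasis A.model 4 k) := by
  rw [T, ContinuousLinearMap.comp_apply, ContinuousLinearEquiv.coe_coe, modelIso_ballBasis]

/-- The chart frame `d(c⁻¹)_y e_k` is `dψ_{g y} (T_y b_k)`. [folklore] -/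
theorem mfderivWithin_symm_modelBasis {y : A.model} (hy : y ∈ c.W) (k : Fin 4) :
    mfderivWithin 𝓘(ℝ, A.model) 𝓘(ℝ, A.model) (extChartAt 𝓘(ℝ, A.model) x₀).symm
        (range 𝓘(ℝ, A.model)) y (modelBasis A.model 4 k) =
      D.unifDerivEquiv A 𝔣 (c.gBall hy) (c.T y (ballBasis k)) := by
  rw [c.mfderivWithin_symm_eq hy, unifDerivEquiv_apply, T_ballBasis]
  rfl

/-- **The chart representative of a top form is `det T_y` times its density**:
`β.inChart x₀ y (e) = det T_y · topDensity β (g y)` for `y ∈ W`. [cite: Warner1983, §4.8] -/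
theorem inChart_apply_modelBasis_eq (β : MForm 𝓘(ℝ, A.model) A.carrier ℝ 4) {y : A.model}
    (hy : y ∈ c.W) :
    β.inChart x₀ y (modelBasis A.model 4) = (c.T y).det * D.topDensity A 𝔣 β (c.gBall hy) := by
  rw [Literature.Geometry.Kaehler.MForm.inChart_apply,
    mform_apply_congr_point A β (c.symm_eq y hy)]
  simp only [c.mfderivWithin_symm_modelBasis hy]
  have h := altTop_apply_equiv_comp ((β (D.modelUnif A 𝔣 (c.g y))).toAlternatingMap)
    (D.unifDerivEquiv A 𝔣 (c.gBall hy)).toLinearEquiv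
    ((c.T y : (Fin 2 → ℂ) →L[ℝ] (Fin 2 → ℂ)) : (Fin 2 → ℂ) →ₗ[ℝ] (Fin 2 → ℂ)) ballBasis
  simp only [ContinuousAlternatingMap.coe_toAlternatingMap, ContinuousLinearMap.coe_coe] at h
  exact h

/-- **The chart orientation sign is `sign (det T_y)` times the ball orientation sign**:
`chartSign o x₀ y = sign (det T_y) · orientSign o (g y)` for `y ∈ W`. [cite: Lee2013, Ch. 15] -/
theorem chartSign_eq (o : (x : A.carrier) → Orientation ℝ (TangentSpace 𝓘(ℝ, A.model) x) (Fin 4))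
    {y : A.model} (hy : y ∈ c.W) :
    chartSign o x₀ y = Real.sign (c.T y).det * D.orientSign A 𝔣 o (c.gBall hy) := by
  rw [chartSign, someVector_apply_congr_point A o (c.symm_eq y hy)]
  simp only [c.mfderivWithin_symm_modelBasis hy]
  have h := altTop_apply_equiv_comp ((o (D.modelUnif A 𝔣 (c.g y))).someVector)
    (D.unifDerivEquiv A 𝔣 (c.gBall hy)).toLinearEquiv
    ((c.T y : (Fin 2 → ℂ) →L[ℝ] (Fin 2 → ℂ)) : (Fin 2 → ℂ) →ₗ[ℝ] (Fin 2 → ℂ)) ballBasis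
  simp only [ContinuousLinearMap.coe_coe] at h
  have h' : (Ray.someVector (o (D.modelUnif A 𝔣 (c.g y))) fun j ↦
      D.unifDerivEquiv A 𝔣 (c.gBall hy) (c.T y (ballBasis j))) =
      LinearMap.det (c.T y : (Fin 2 → ℂ) →ₗ[ℝ] (Fin 2 → ℂ)) * D.orientVal A 𝔣 o (c.gBall hy) := h
  rw [h', real_sign_mul]
  rfl

/-- **The chart integrand of `∫_X β`** at `y ∈ W`:
`chartSign · (ρ ∘ c⁻¹) · β.inChart (e) = |det T_y| · (orientSign · (ρ ∘ ψ) · topDensity β) (g y)`.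
[cite: Warner1983, §4.8] -/
theorem chartIntegrand_eq (o : (x : A.carrier) → Orientation ℝ (TangentSpace 𝓘(ℝ, A.model) x) (Fin 4))
    (ρ : A.carrier → ℝ) (β : MForm 𝓘(ℝ, A.model) A.carrier ℝ 4) {y : A.model} (hy : y ∈ c.W) :
    chartSign o x₀ y * ρ ((extChartAt 𝓘(ℝ, A.model) x₀).symm y) *
        β.inChart x₀ y (modelBasis A.model 4) =
      |(c.T y).det| * (D.orientSign A 𝔣 o (c.gBall hy) * ρ (D.modelUnif A 𝔣 (c.g y)) *
        D.topDensity A 𝔣 β (c.gBall hy)) := by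
  rw [c.chartSign_eq o hy, c.inChart_apply_modelBasis_eq β hy, c.symm_eq y hy,
    ← real_sign_mul_self]
  ring

end ChartInverseAt

end UnitaryBallUniformisationDatum

end Literature.AlgebraicGeometry.ShimuraVarieties

end
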